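import Summits.QuantumFields.YangMills.Theorems.UnitScaleTiltFluctuationComparisonRegPrLiftLegsSlice
import Summits.QuantumFields.YangMills.Theorems.UnitScaleTiltFluctuationComparisonRegPrLiftLegsAssembly
import Summits.QuantumFields.YangMills.Theorems.UnitScaleTiltFluctuationComparisonRegPrCertL3Clause

/-!
# Route `UnitScaleTilt` — crux `FluctuationComparisonRegPrL` (stmt-QuantumFields-19935), stub `stub_oneStepSmallLift`: the Γ-LEG LAYER, file 11 —
# THE PER-`L` CLAUSE FOR EVERY ODD `L ≥ 5` FROM «ANSATZ T» MODULO ITS ROW BOUND, and the shape of the final theorem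
# (support file `--supports stmt-QuantumFields-19935`)

Cell `ym3-torus` (HUMAN RULING D-0037, YM ladder rung R3), seat `ym3-torus-p1` gen 11 (UV side; memo HOME/UV3-NODE.md §20.5).  With
`CertL3Tree.certL3_clause` (L = 3, file `…CertL3Clause`) and `oneStepSmallLift_stub_of_perL` (file `…LiftLegsSlice`) the registered stub needs only
the per-`L` clause at every odd `L ≥ 5`.  ym3-torus-p2 g10's tensor table `AnsatzT.kzT L` (interior-supported, `R = 1`) has `SliceNeutral`
(`sliceNeutral_T`) and row mass `162` (`rowMass_T`) in the tree; its row bound `RowBound (Fin 2) 1 (kzT L) λ_T β_T` with `λ_T√L < 1` is being typed.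
This file pre-assembles everything else:

* **`perL_clause_T_of_rowBound`**: `Odd L → 5 ≤ L → (0 ≤ λ, 0 ≤ β, λ√L < 1) → (∀ m K hL, RowBound (P := ⟨3,L,m,K,…⟩) (Fin 2) 1 (kzT L) λ β) →`
  the per-`L` clause at `L` (via `exists_approxSmallLift_of_kernel_lineNeutral`, `lineNeutral_of_sliceNeutral sliceNeutral_T`, `rowMass_T`);
* **`stub_oneStepSmallLift_of_rowBoundT`**: the registered signature of `stub_oneStepSmallLift` from such a row bound at every odd `L ≥ 5` — so the
  stub closes BY NAME with the one-liner `stub_oneStepSmallLift_of_rowBoundT lamT betaT hlam hβ hgain rowBound_T` once p2's row bound lands.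

Elementary bookkeeping; nothing of Bałaban's is asserted.
-/

noncomputable section

namespace Summit.QuantumFields.YangMills.Theorems.ApproxLift

open Literature.MathematicalPhysics.QuantumFieldTheory.Balaban1983to89
open Literature.MathematicalPhysics.QuantumFieldTheory.Balaban1983to89.T3ContinuumYM3Torus
open Literature.MathematicalPhysics.QuantumFieldTheory.Balaban1983to89.T3UnitLawDensityEML (ℰp)
open Literature.MathematicalPhysics.QuantumFieldTheory.Balaban1983to89.T3SmallLiftHistory (OneStepSmallLift)

/-- **THE PER-`L` CLAUSE FOR ODD `L ≥ 5` FROM THE TENSOR TABLE `kzT`, MODULO ITS ROW BOUND**: slice-neutrality and row mass `162` are in the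
tree (p2 g10); given a row bound `(λ, β)` at every run with `λ√L < 1`, the Γ-leg assembly yields the per-`L` hypothesis of
`oneStepSmallLift_stub_of_approx` at `L`. -/
theorem perL_clause_T_of_rowBound {L : ℕ} (hodd : Odd L) (h5 : 5 ≤ L) {lam β : ℝ} (hlam : 0 ≤ lam) (hβ : 0 ≤ β)
    (hgain : lam * Real.sqrt L < 1)
    (hRB : ∀ (m K : ℕ) (hL : Odd L ∧ 1 < L), RowBound (P := AnsatzS.P3 L m K hL) (Fin 2) 1 (AnsatzT.kzT L) lam β) :
    ∃ κ₀ C δ₀ : ℝ, 0 ≤ κ₀ ∧ κ₀ * Real.sqrt L < 1 ∧ 0 ≤ C ∧ 0 < δ₀ ∧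
      ∀ F : T3Family, F.L = L → ApproxSmallLift F κ₀ C δ₀ := by
  have hL' : Odd L ∧ 1 < L := ⟨hodd, by omega⟩
  refine exists_approxSmallLift_of_kernel_lineNeutral L 1 (fun F => AnsatzT.kzT F.L) (K₁ := 162) (by norm_num) hlam hβ hgain
    (Cq_nonneg (AnsatzS.P3 L 1 0 hL') 1 (K₁ := 162) hlam hβ (by norm_num)) (Ca_nonneg (AnsatzS.P3 L 1 0 hL') 1 (K₁ := 162) (by norm_num))
    fun F hFL => ?_
  obtain ⟨L', hL'', m, hm⟩ := F
  simp only at hFL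
  subst hFL
  refine ⟨le_of_eq rfl, le_of_eq rfl, fun K => ⟨?_, ?_, ?_⟩⟩
  · exact lineNeutral_of_sliceNeutral (AnsatzT.sliceNeutral_T (m := m) (K := K) (hL := hL'') hodd)
  · exact AnsatzT.rowMass_T (m := m) (K := K) (hL := hL'') hodd (by omega)
  · exact hRB m K hL''

/-- **THE REGISTERED SIGNATURE OF `stub_oneStepSmallLift` FROM A ROW BOUND OF THE TENSOR TABLE AT EVERY ODD `L ≥ 5`** (gain and Bianchi
constants `lamT L`, `betaT L` with `lamT L · √L < 1`): `L = 3` by `CertL3Tree.certL3_clause`, odd `L ≥ 5` by `perL_clause_T_of_rowBound`, all other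
`L` vacuous (`oneStepSmallLift_stub_of_perL`). -/
theorem stub_oneStepSmallLift_of_rowBoundT (lamT betaT : ℕ → ℝ) (hlam : ∀ L, Odd L → 5 ≤ L → 0 ≤ lamT L) (hβ : ∀ L, Odd L → 5 ≤ L → 0 ≤ betaT L)
    (hgain : ∀ L, Odd L → 5 ≤ L → lamT L * Real.sqrt L < 1)
    (hRB : ∀ L, Odd L → 5 ≤ L → ∀ (m K : ℕ) (hL : Odd L ∧ 1 < L),
      RowBound (P := AnsatzS.P3 L m K hL) (Fin 2) 1 (AnsatzT.kzT L) (lamT L) (betaT L)) :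
    ∀ L : ℕ, ∃ κ δ₀ : ℝ, κ * Real.sqrt L ≤ 1 ∧ 0 < δ₀ ∧ ∀ F : T3Family, F.L = L → OneStepSmallLift F ℰp κ δ₀ :=
  oneStepSmallLift_stub_of_perL CertL3Tree.certL3_clause fun L hodd h5 =>
    perL_clause_T_of_rowBound hodd h5 (hlam L hodd h5) (hβ L hodd h5) (hgain L hodd h5) (hRB L hodd h5)

end Summit.QuantumFields.YangMills.Theorems.ApproxLift

end
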